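import Mathlib
import Summits.PneNP.PneNP.Theorems.PstarUniformRepeats
import Summits.PneNP.PneNP.Theorems.PstarSA2Blind

/-!
# Calibration: an FP-easy pure `P⋆` family on which level-2 Sherali–Adams (+ PSD) is blind (ROUND-24 item T24.4′)

FRONTIER range-avoidance ladder, ROUND-24 item T24.4′ (cell `pnp-ideate`, planner seat p3's pre-seed §6(2); restricted-model
calibration — nothing here bears on `P` versus `NP`).

The honest-scope line of the ladder («SA-blindness does not imply hardness», ROUND-20 memo §11) as a kernel theorem at
LEVEL 2: for every stretch `C ≥ 3` there are typed pure `P⋆` instances `I : LocalMap 4 (N+N) (C·(N+N))` that are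

* in the LINEARISABLE class `PstarLinearisation.LinearisablePstar` (`n + #{distinct AND pairs} < m`), hence solved by the ONE
  polynomial-time function `linStr` of rung R20-lin (`PstarLinearisation.pstarLinearisable_localAvoidLinearFP`; here
  concretely `readOut _ (linStr I.encode) ∉ I.range`), and yet
* level-2 blind for EVERY target: `PstarSA2Blind.SA2Feasible I y` for all `y` (`PstarSA2Blind.sa2Feasible_of_typed` —
  typedness alone suffices), with non-range points present (`n < m`).

The family is the TWIN family: output `j` of `twin ω₀` copies output `⌊j/2⌋` of an arbitrary typed outcome `ω₀` with `C·N`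
outputs (same XOR pair, same AND pair), so at most `C·N` distinct AND pairs serve `2·C·N` outputs on `2N` variables.
Why level 2 and not linear level: a linearisable typed instance is never `(r, a/b)`-boundary expanding with `a/b > 1` beyond
radius `O(log N)` (twins along short cycles of the XOR graph have boundary ratio exactly `1` — the cell's obstruction note,
prover-1/p3/referee 2026-08-28), so the hub `PairwiseSALinearLevel` cannot certify linear-level blindness of such a family;
that would need a block peel (T24.4″, open).  This file records the level-2 calibration only.
-/

set_option linter.dupNamespace false -- `Summit.PneNP.PneNP.…`: summit = sub-problem name (D-0017 single-conjunct layout)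

open Finset Literature.Computability.Complexity
open Summit.PneNP.PneNP.Theorems.PstarExpandingModel (DPair Outcome inst isPure_inst typed_inst)
open Summit.PneNP.PneNP.Theorems.PstarLinearisation (numAndPairs LinearisablePstar linStr linStr_correct)
open Summit.PneNP.PneNP.Theorems.PstarUniformRepeats (akey img dval numAndPairs_inst)
open Summit.PneNP.PneNP.Theorems.PstarTyped (Typed)
open Summit.PneNP.PneNP.Theorems.PstarSA2Blind (SA2Feasible sa2Feasible_of_typed exists_not_mem_range)

namespace Summit.PneNP.PneNP.Theorems.PstarLinearisableSA2

variable {N C : ℕ}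

/-! ## The twin family -/

/-- Output `j` of the twin outcome is output `⌊j/2⌋` of `ω₀`. -/
theorem div_two_lt (j : Fin (C * (N + N))) : j.val / 2 < C * N := by
  have h := j.isLt
  have e : C * (N + N) = 2 * (C * N) := by ring
  omega

/-- **The twin outcome**: every output of `ω₀ : Outcome N (C·N)` is used twice (outputs `2i` and `2i+1` read the same XOR
pair and the same AND pair). -/
def twin (ω₀ : Outcome N (C * N)) : Outcome N (C * (N + N)) := fun j => ω₀ ⟨j.val / 2, div_two_lt j⟩

/-- The AND keys of the twin outcome are AND keys of `ω₀`. -/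
theorem img_twin_subset (ω₀ : Outcome N (C * N)) : img (twin ω₀) ⊆ img ω₀ := by
  intro b hb
  obtain ⟨j, -, rfl⟩ := mem_image.1 hb
  exact mem_image.2 ⟨⟨j.val / 2, div_two_lt j⟩, mem_univ _, rfl⟩

/-- Hence at most `C·N` distinct AND pairs. -/
theorem numAndPairs_twin_le (ω₀ : Outcome N (C * N)) : numAndPairs (inst (twin ω₀)) ≤ C * N := by
  rw [numAndPairs_inst]
  unfold PstarUniformRepeats.dval
  refine (card_le_card (img_twin_subset ω₀)).trans ?_
  unfold PstarUniformRepeats.img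
  exact card_image_le.trans (by rw [card_univ, Fintype.card_fin])

/-- **The twin instances are linearisable** for `C ≥ 3`, `N ≥ 1`: `2N + C·N < 2·C·N`. -/
theorem linearisable_twin (hC : 3 ≤ C) (hN : 1 ≤ N) (ω₀ : Outcome N (C * N)) :
    LinearisablePstar (inst (twin ω₀)) := by
  refine ⟨isPure_inst _, ?_⟩
  have h := numAndPairs_twin_le ω₀
  have h2 : N + N + C * N < C * (N + N) := by nlinarith
  omega

/-- **T24.4′ (pointwise form).**  For `C ≥ 3`, `N ≥ 1` and ANY outcome `ω₀` with `C·N` outputs, the twin instance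
`I = inst (twin ω₀) : LocalMap 4 (N+N) (C·(N+N))` is pure, typed, linearisable — the polynomial-time `linStr` prints a point
outside its range — and level-2 (Sherali–Adams + PSD moment matrix) feasible for EVERY target. -/
theorem twin_calibration (hC : 3 ≤ C) (hN : 1 ≤ N) (ω₀ : Outcome N (C * N)) :
    (inst (twin ω₀)).IsPure xorAndPred ∧ Typed (inst (twin ω₀)) ∧ LinearisablePstar (inst (twin ω₀)) ∧
      readOut (C * (N + N)) (linStr (inst (twin ω₀)).encode) ∉ (inst (twin ω₀)).range ∧
        ∀ y, SA2Feasible (inst (twin ω₀)) y := by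
  have hL := linearisable_twin hC hN ω₀
  exact ⟨isPure_inst _, typed_inst _, hL, linStr_correct _ hL.1 hL.2,
    fun y => sa2Feasible_of_typed _ (isPure_inst _) (typed_inst _) y⟩

/-- Outcomes exist once `N ≥ 2`. -/
theorem nonempty_outcome (hN : 2 ≤ N) (m : ℕ) : Nonempty (Outcome N m) := by
  have h0 : 0 < N := by omega
  have h1 : 1 < N := by omega
  exact ⟨fun _ => (⟨(⟨0, h0⟩, ⟨1, h1⟩), by simp [Fin.ext_iff]⟩, ⟨(⟨0, h0⟩, ⟨1, h1⟩), by simp [Fin.ext_iff]⟩)⟩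

/-- **T24.4′ — linearisable (FP-easy) yet level-2 blind, at every stretch `C ≥ 3`** (planner's shape, even `n = N+N`):
there is a typed pure `P⋆` instance with `C·n` outputs that is in `LinearisablePstar` (range avoidance solved in FP by
`pstarLinearisable_localAvoidLinearFP`), has a point outside its range, and is `SA2Feasible` for every target.  So level-2
blindness certifies nothing about hardness; the linear-level analogue is open (T24.4″).  Restricted-model calibration of the
range-avoidance ladder; it says nothing about `P` versus `NP`. -/
theorem linearisable_sa2Blind (C N : ℕ) (hC : 3 ≤ C) (hN : 2 ≤ N) :
    ∃ I : LocalMap 4 (N + N) (C * (N + N)), I.IsPure xorAndPred ∧ Typed I ∧ LinearisablePstar I ∧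
      (∃ y, y ∉ I.range) ∧ ∀ y, SA2Feasible I y := by
  obtain ⟨ω₀⟩ := nonempty_outcome hN (C * N)
  obtain ⟨h1, h2, h3, -, h5⟩ := twin_calibration hC (by omega) ω₀
  exact ⟨inst (twin ω₀), h1, h2, h3, exists_not_mem_range _ (by nlinarith), h5⟩

end Summit.PneNP.PneNP.Theorems.PstarLinearisableSA2
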